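import Literature.NumberTheory.EllipticCurves.ComplexMultiplicationDeuringLocalPlaces
import Literature.NumberTheory.EllipticCurves.Castella2018.TamagawaQuadraticBaseChangeProofs
import Literature.NumberTheory.GaloisRepresentations.FrobeniusPlaces
import Literature.NumberTheory.GaloisRepresentations.FrobeniusDensityTheorem
import Literature.NumberTheory.GaloisRepresentations.ArtinFormalismInductionProofs
import Mathlib.NumberTheory.RamificationInertia.Unramified
import HarnessLib

/-!
# Plumbing for the Chebotarev step of (c′): split primes of a quadratic field from residue degrees; openness of `res(res Γ_R)`
# (cell `bsd-stepL`, seat `bsd-stepL-corner3-p2` g15 = lane B, LINE OWNER of crux 21420 `CornerAtThreeW`; `--supports stmt-BirchSwinnertonDyer-21420 --as helper`)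

WHY. Two bookkeeping lemmas for the Chebotarev step `exists_splitAuxPrime_of_witness` (sibling `…SplitAuxPrimeOfWitness`) of conjunct (c′)
of the r18/r19 residual stub of `Cruxes/CornerAtThreeW/Lines/inert.lean`: (1) `ncard_primesOver_eq_two_of_forall_inertiaDeg_eq_one` — a
rational prime unramified in the quadratic field `K` all of whose places have residue degree `1` has exactly two primes above it (the
fundamental identity; tree `placesOver_trichotomy_of_finrank_eq_two`, `Castella2018.TamagawaQuadratic.ncard_primesOver_span_eq`);
(2) `isOpen_map_range_absGaloisRestrict` — for a finite Galois `R/K`, the doubly restricted subgroup `res_{K/ℚ}(res_{R/K}(Γ_R)) ≤ Γ_ℚ` is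
OPEN (closed as a continuous image of a compact set, of finite index `[K:ℚ]·[R:K]`).
HONEST FRAMING: THEOREMS ONLY (no definition, no named fact, no `sorry`); nothing about any curve, CM point or crux object; no stub ∕ item
closes; 21420 OPEN; no census label moves (T7); BSD is proved for no curve.
References (locators only): [cite: NeukirchANT1999, Ch. I §8 (8.2), Ch. IV §1] [cite: Marcus2018, Ch. 3 Thm. 25].
presearch: in-tree (the two cited tree lemmas; `index_range_absGaloisRestrict_eq_finrank`, `isClosed_range_absGaloisRestrict`). Axioms:
`propext`, `Classical.choice`, `Quot.sound`.
-/

set_option autoImplicit false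
set_option linter.dupNamespace false -- `Summit.BirchSwinnertonDyer.BirchSwinnertonDyer` (summit = problem), tree-wide

noncomputable section

open scoped Classical Pointwise NumberField
open NumberField IsDedekindDomain Field Rat.HeightOneSpectrum
open Literature.NumberTheory.GaloisRepresentations Literature.NumberTheory.EllipticCurves

namespace Summit.BirchSwinnertonDyer.BirchSwinnertonDyer.Theorems.ChebKummerThree

/-! ### §1 Plumbing -/

/-- **A prime of a quadratic field all of whose places above it have residue degree `1`, and which is unramified, SPLITS**:
`#{𝔭 ∣ ℓ} = 2` (fundamental identity `Σ eᵢfᵢ = 2`; tree trichotomy `placesOver_trichotomy_of_finrank_eq_two`).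
[cite: NeukirchANT1999, Ch. I §8 (8.2)] -/
theorem ncard_primesOver_eq_two_of_forall_inertiaDeg_eq_one {K : Type} [Field K] [NumberField K]
    (h2 : Module.finrank ℚ K = 2) {ℓ : ℕ} {v : HeightOneSpectrum (𝓞 ℚ)} (hv : (primesEquiv v : ℕ) = ℓ)
    (hunr : Algebra.IsUnramifiedIn (𝓞 K) v.asIdeal)
    (hf1 : ∀ w : HeightOneSpectrum (𝓞 K), w.under (𝓞 ℚ) = v → w.asIdeal.inertiaDeg (𝓞 ℚ) = 1) :
    ((Ideal.span {(ℓ : ℤ)}).primesOver (𝓞 K)).ncard = 2 := by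
  rw [← hv, Castella2018.TamagawaQuadratic.ncard_primesOver_span_eq K v]
  rcases placesOver_trichotomy_of_finrank_eq_two K h2 v with
    ⟨w₁, w₂, hne, hset, -⟩ | ⟨w, hset, -, hf2⟩ | ⟨w, hset, he2, -⟩
  · rw [hset, Set.ncard_pair hne]
  · exfalso
    have hw : w.under (𝓞 ℚ) = v := by
      have : w ∈ ({w' : HeightOneSpectrum (𝓞 K) | w'.under (𝓞 ℚ) = v}) := by rw [hset]; rfl
      exact this
    rw [hf1 w hw] at hf2
    norm_num at hf2
  · exfalso
    have hw : w.under (𝓞 ℚ) = v := by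
      have : w ∈ ({w' : HeightOneSpectrum (𝓞 K) | w'.under (𝓞 ℚ) = v}) := by rw [hset]; rfl
      exact this
    haveI : w.asIdeal.LiesOver v.asIdeal := ⟨(congrArg HeightOneSpectrum.asIdeal hw).symm⟩
    have he1 : w.asIdeal.ramificationIdx (𝓞 ℚ) = 1 :=
      (Algebra.isUnramifiedIn_iff_forall_ramificationIdx_eq_one.mp hunr) w.asIdeal ‹_›
    rw [he1] at he2
    norm_num at he2

/-- The doubly restricted subgroup `res_{K/ℚ}(res_{R/K}(Γ_R)) ≤ Γ_ℚ` is OPEN (closed — a continuous image of a compact set — and of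
finite index `2·[R:K]`). [folklore] -/
theorem isOpen_map_range_absGaloisRestrict (K : Type) [Field K] [NumberField K] (hK2 : Module.finrank ℚ K = 2)
    (R : Type) [Field R] [NumberField R] [Algebra K R] [FiniteDimensional K R] [IsGalois K R] :
    IsOpen ((((absGaloisRestrict K R).range).map (absGaloisRestrict ℚ K).toMonoidHom :
      Subgroup (absoluteGaloisGroup ℚ)) : Set (absoluteGaloisGroup ℚ)) := by
  haveI : FiniteDimensional ℚ K := Module.finite_of_finrank_eq_succ hK2
  haveI : Algebra.IsAlgebraic ℚ K := Algebra.IsAlgebraic.of_finite ℚ K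
  set HR := ((absGaloisRestrict K R).range).map (absGaloisRestrict ℚ K).toMonoidHom with hHR
  -- closed: continuous image of the compact closed subgroup `res(Γ_R)`
  have hclosed : IsClosed (HR : Set (absoluteGaloisGroup ℚ)) := by
    have hc : IsCompact (((absGaloisRestrict K R).range : Subgroup (absoluteGaloisGroup K)) : Set (absoluteGaloisGroup K)) := by
      have : (((absGaloisRestrict K R).range : Subgroup (absoluteGaloisGroup K)) : Set (absoluteGaloisGroup K)) =
          Set.range (absGaloisRestrict K R) := by ext; simp
      rw [this]
      exact (isClosed_range_absGaloisRestrict K R).isCompact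
    have himg : (HR : Set (absoluteGaloisGroup ℚ)) = (absGaloisRestrict ℚ K) '' (((absGaloisRestrict K R).range :
        Subgroup (absoluteGaloisGroup K)) : Set (absoluteGaloisGroup K)) := by
      rw [hHR, Subgroup.coe_map]; rfl
    rw [himg]
    exact (hc.image (absGaloisRestrict ℚ K).continuous).isClosed
  -- finite index
  haveI : HR.FiniteIndex := by
    refine ⟨?_⟩
    have hidx := Subgroup.index_map_of_injective (H := (absGaloisRestrict K R).range)
      (f := (absGaloisRestrict ℚ K).toMonoidHom) (fun a b h ↦ absGaloisRestrict_injective ℚ K h)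
    have h1 : ((absGaloisRestrict K R).range).index = Module.finrank K R := index_range_absGaloisRestrict_eq_finrank K R
    have h2 : ((absGaloisRestrict ℚ K).toMonoidHom.range).index = Module.finrank ℚ K :=
      index_range_absGaloisRestrict_eq_finrank ℚ K
    have hne : ((absGaloisRestrict K R).range).index * ((absGaloisRestrict ℚ K).toMonoidHom.range).index ≠ 0 := by
      rw [h1, h2, hK2]
      exact mul_ne_zero Module.finrank_pos.ne' two_ne_zero
    intro h0
    exact hne (hidx ▸ h0)
  exact Subgroup.isOpen_of_isClosed_of_finiteIndex HR hclosed


end Summit.BirchSwinnertonDyer.BirchSwinnertonDyer.Theorems.ChebKummerThree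

end
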